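import Summits.ResolutionOfSingularities.ResolutionOfSingularities.Theses.Valuative
import Summits.ResolutionOfSingularities.ResolutionOfSingularities.Theorems.ValuativePatchingRelResolvingSystem
import Summits.ResolutionOfSingularities.ResolutionOfSingularities.Theorems.ValuativePatchingRelRegLeificationOfLocal
import Summits.ResolutionOfSingularities.ResolutionOfSingularities.Theorems.ValuativePatchingRelLocalRegLeification
import Summits.ResolutionOfSingularities.ResolutionOfSingularities.Theorems.ValuativePatchingRelOpenGluing
import Summits.ResolutionOfSingularities.ResolutionOfSingularities.Theorems.ValuativePatchingRelProperExtension
import Literature.AlgebraicGeometry.Resolution.ProperModelsPatching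
import Literature.AlgebraicGeometry.Resolution.ProperModelsPatchingGluing
import Literature.AlgebraicGeometry.Morphisms.OpenGluingProofs
import Literature.AlgebraicGeometry.Morphisms.NagataCompactification

/-!
# drefute gen 4 — state certificate of the 8 registered stubs of line `sandwiched-gluing`
# (crux stmt-ResolutionOfSingularities-0642, `Valuative.PatchingRel`), tree at 2026-08-16T03:10Z

Registered signatures verbatim (workitem `stubs[]`, active). S1–S5 and the capstone are closed by
`exact` with the lead's LANDED Theorems declarations (so they are theorems of the tree and not
refutable); S6 (named fact) and S7 (open atom) remain the only `sorry`s.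
-/

open CategoryTheory AlgebraicGeometry
open Literature.AlgebraicGeometry.Resolution Literature.AlgebraicGeometry.Morphisms
open Summit.ResolutionOfSingularities.ResolutionOfSingularities

namespace DrefuteG4

theorem S1 : ∀ p : ℕ, p.Prime → ProperModel.TwoModelPatching.{0} p → (∀ (k K : Type) [Field k] [CharP k p] [Field K] [Algebra k K], (⊤ : IntermediateField k K).FG → ∀ O : ValuationSubring K, (∀ c : k, algebraMap k K c ∈ O) → ∀ R : Subalgebra k K, R.FG → R.toSubring ≤ O.toSubring → ∃ (A : Subalgebra k K) (h : A.toSubring ≤ O.toSubring), R ≤ A ∧ A.FG ∧ IsFractionRing A K ∧ IsRegularLocalRing (Localization.AtPrime (Ideal.comap (Subring.inclusion h) (IsLocalRing.maximalIdeal O)))) → ResolutionInChar.{0} p :=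
  Theorems.stub_resolutionInChar_of_properPatching

theorem S2 : ∀ p : ℕ, (∀ (k : Type) [Field k] (K : Type) [Field K] [Algebra k K] (P : ProperModel k K) (U : P.X.Opens) (Y : Scheme.{0}) [IsIntegral Y] (g : Y ⟶ (U : Scheme.{0})) [IsProper g], IsBirational g → ∃ (P' : ProperModel k K) (φ : P'.Hom P) (i : Y ⟶ P'.X), IsOpenImmersion i ∧ IsPullback i g φ.f U.ι) → ProperModel.LocalRegLeification.{0} p → ProperModel.RegLeification.{0} p :=
  Theorems.stub_regLeification_of_local

theorem S3 : ∀ p : ℕ, OpenGluing.{0} → SandwichedStrongResolution.{0} p → ProperModel.LocalRegLeification.{0} p :=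
  Theorems.stub_localRegLeification_of_sandwiched

theorem S4 : OpenGluing.{0} := Theorems.stub_openGluing

theorem S5 : NagataCompactification.{0} → ∀ (k : Type) [Field k] (K : Type) [Field K] [Algebra k K] (P : ProperModel k K) (U : P.X.Opens) (Y : Scheme.{0}) [IsIntegral Y] (g : Y ⟶ (U : Scheme.{0})) [IsProper g], IsBirational g → ∃ (P' : ProperModel k K) (φ : P'.Hom P) (i : Y ⟶ P'.X), IsOpenImmersion i ∧ IsPullback i g φ.f U.ι :=
  Theorems.stub_properExtension_of_nagata

/-- S6 — NAMED FACT (Conrad 2007 Thm 4.1 / Stacks 0F41). -/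
theorem S6 : NagataCompactification.{0} := by
  sorry

/-- S7 — the OPEN ATOM SAND⁺. -/
theorem S7 : ∀ p : ℕ, p.Prime → SandwichedStrongResolution.{0} p := by
  sorry

/-- Capstone (registered 02:39Z, landed 03:00Z as `Theorems/ValuativePatchingRel.lean`). -/
theorem S8 : NagataCompactification.{0} → (∀ p : ℕ, p.Prime → SandwichedStrongResolution.{0} p) → Summit.ResolutionOfSingularities.ResolutionOfSingularities.Theses.Valuative.PatchingRel :=
  -- literally the term of the landed `Theorems.patchingRel_of_nagata_of_sandwiched`
  -- (`Theorems/ValuativePatchingRel.lean`, in the tree since 03:00Z; not yet built on the farm at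
  -- the time of this check, hence restated over its Literature constituents)
  fun hN hS p hp hLU =>
    SandwichedGluing.resolutionInChar_of_nagata_openGluing_sand p hN OpenGluing_holds (hS p hp) hLU

/-- SHARPER capstone at zero cost: the antecedent `LUrel_p` of the crux may be kept as a hypothesis
of the atom — the exact residual of the line modulo Nagata is `∀ p prime, LUrel_p → SAND⁺_p`,
not `∀ p prime, SAND⁺_p`. -/
theorem S8_sharp (hN : NagataCompactification.{0})
    (hS : ∀ p : ℕ, p.Prime →
      (∀ (k K : Type) [Field k] [CharP k p] [Field K] [Algebra k K], (⊤ : IntermediateField k K).FG → ∀ O : ValuationSubring K, (∀ c : k, algebraMap k K c ∈ O) → ∀ R : Subalgebra k K, R.FG → R.toSubring ≤ O.toSubring → ∃ (A : Subalgebra k K) (h : A.toSubring ≤ O.toSubring), R ≤ A ∧ A.FG ∧ IsFractionRing A K ∧ IsRegularLocalRing (Localization.AtPrime (Ideal.comap (Subring.inclusion h) (IsLocalRing.maximalIdeal O)))) →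
      SandwichedStrongResolution.{0} p) :
    Summit.ResolutionOfSingularities.ResolutionOfSingularities.Theses.Valuative.PatchingRel :=
  fun p hp hLU =>
    SandwichedGluing.resolutionInChar_of_nagata_openGluing_sand p hN OpenGluing_holds (hS p hp hLU) hLU

theorem crux_of_stubs : Summit.ResolutionOfSingularities.ResolutionOfSingularities.Theses.Valuative.PatchingRel :=
  S8 S6 S7

end DrefuteG4
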